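import Summits.ResolutionOfSingularities.ResolutionOfSingularities.Theorems.FrobeniusLadderFInjectiveMacaulayficationRegularPointClause
import Literature.AlgebraicGeometry.Resolution.ThreefoldResolutionOneBlowup
import Literature.AlgebraicGeometry.Resolution.QuasiExcellentSchemes
import Literature.AlgebraicGeometry.Resolution.ResolutionGlue
import Literature.AlgebraicGeometry.CossartPiltant200819.GoodResolutionOneBlowupQuasiExcellent2019
import HarnessLib.Audit
import HarnessLib

/-!
# The closed-centre stub `#4β` of door v30 in dimension three (crux `FInjectiveMacaulayfication`)

[OURS · L1 W4.5a] Support file for crux stmt-ResolutionOfSingularities-15315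
(`Summit.ResolutionOfSingularities.ResolutionOfSingularities.Theses.FrobeniusLadder.FInjectiveMacaulayfication`, route
`FrobeniusLadder`).  Door v30 (`L/res-L1-w45a-lead-1/DoorUnguarded.lean`, plan-1 R13.35) has the three stubs
`stub_dattaMurayama`, `stub_fcUnguarded` (FC″, generic-fibre stage) and `stub_closedCentreExists` (#4β, the CLOSED stage:
at a bad closed point `b` of an admissible `X₁` there is a non-zero ideal sheaf `J` with `b ∈ Supp J` such that EVERY blowing
up of `X₁` along `J` is FULL — domain, Cohen–Macaulay clause, `F`-injectivity clause — at every point over `Supp J`).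

This file lands the **dimension-three rung of the closed stub**: `#4β` with the single extra hypothesis
`topologicalKrullDim X₁ = 3` (inserted after `IsIntegral X₁`, the convention of `FCForallExistsDimLe2`) holds, GIVEN the three
named facts behind the tree's one-blowing-up resolution of threefolds
(`Literature.AlgebraicGeometry.Resolution.exists_isBlowup_isRegular_of_dim_three`): Cossart–Piltant 2019 Thm. 1.1 (i)(ii)
(`CossartPiltant2019General`), Raynaud–Gruson flattening / Stacks 081R (`Stacks081R`) and CP 2019 Prop. 4.4
(`CossartPiltant2019Principalization`).  Proof: that theorem gives a non-zero ideal sheaf `𝓛` on `X₁` and a blowing up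
`ρ : T → X₁` along `𝓛` with `T` regular and `Supp 𝓛 = X₁ ∖ Reg X₁`
(`CP2019.support_eq_compl_regularLocus_of_isBlowup_of_isRegular`); the bad point `b` is not regular (a regular stalk satisfies
the full clause, `RegularPointClause.fiClause_of_mem_regularLocus`), so `b ∈ Supp 𝓛`; and ANY blowing up `π : X' → X₁` along
`𝓛` is isomorphic to `ρ` over `X₁` (`IsBlowup.unique`), so `X'` is regular (`Scheme.IsRegular.of_iso`) and every stalk of `X'`
satisfies the full clause.  No tame/wild distinction, no projectivity and no Macaulayfication is needed in dimension three: the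
centre `J := 𝓛` resolves outright.  (In dimension `≥ 4` no such `𝓛` is known — that is where `#4β` is open; the informative
regime for the K-arena is therefore `dim X₁ ≥ 4`, see the strategist memo `L/res-L1-w45a-strat-1/WFIX-DIM3.md`.)

* `ClosedCentreExistsDimEq3` — the statement (`#4β` verbatim + `topologicalKrullDim X₁ = 3`);
* `closedCentreExistsDimEq3_of_cp` — its proof from the three named facts (universe `0`).

AI-written, weaker than expert review; no statement of [claim: Hironaka2017] is used; the named facts enter only as hypotheses.
-/

-- single-problem summit: the doubled namespace component is forced
set_option linter.dupNamespace false

noncomputable section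

open CategoryTheory AlgebraicGeometry
open Literature.AlgebraicGeometry.Resolution
open Literature.AlgebraicGeometry.CossartPiltant200819
open Summit.ResolutionOfSingularities.ResolutionOfSingularities.Theorems.FInjectiveMacaulayfication

namespace Summit.ResolutionOfSingularities.ResolutionOfSingularities.Theorems.FInjectiveMacaulayfication.ClosedCentreDimEq3

/-- [OURS · candidate statement, PROVED below modulo the three named facts] **The closed-centre stub `#4β` of door v30 for
threefolds** — the text of `stub_closedCentreExists` VERBATIM with the single extra hypothesis `topologicalKrullDim X₁ = 3` inserted
after `IsIntegral X₁`: for an admissible integral threefold `X₁` (separated, of finite type over a field of characteristic `p`, all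
stalks Cohen–Macaulay in the clause sense, finitely many non-`F`-injective points) and a bad closed point `b`, some non-zero ideal
sheaf `J` with `b ∈ Supp J` has ALL its blowing ups FULL at every point over `Supp J`. [candidate statement, OURS] -/
@[conjecture] def ClosedCentreExistsDimEq3 : Prop :=
    ∀ (p : ℕ), p.Prime → ∀ (k : Type) [Field k] [CharP k p] (X₁ : Scheme.{0}) (f₁ : X₁ ⟶ Spec (.of k)),
    IsSeparated f₁ → LocallyOfFiniteType f₁ → QuasiCompact f₁ → IsIntegral X₁ → topologicalKrullDim X₁ = 3 →
    (∀ x : X₁, ∀ d : ℕ, ringKrullDim (X₁.presheaf.stalk x) = d → ∀ s : Fin d → X₁.presheaf.stalk x, (Ideal.span (Set.range s)).radical.IsMaximal → RingTheory.Sequence.IsWeaklyRegular (X₁.presheaf.stalk x) (List.ofFn s)) →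
    Set.Finite {x : X₁ | ¬ ∀ d : ℕ, ringKrullDim (X₁.presheaf.stalk x) = d → ∀ s : Fin d → X₁.presheaf.stalk x, (Ideal.span (Set.range s)).radical.IsMaximal → ∀ y : X₁.presheaf.stalk x, (∃ e : ℕ, y ^ p ^ e ∈ Ideal.span ((fun z : X₁.presheaf.stalk x => z ^ p ^ e) '' (Ideal.span (Set.range s) : Set (X₁.presheaf.stalk x)))) → y ∈ Ideal.span (Set.range s)} →
    ∀ b : X₁, IsClosed ({b} : Set X₁) → (¬ ∀ d : ℕ, ringKrullDim (X₁.presheaf.stalk b) = d → ∀ s : Fin d → X₁.presheaf.stalk b, (Ideal.span (Set.range s)).radical.IsMaximal → ∀ y : X₁.presheaf.stalk b, (∃ e : ℕ, y ^ p ^ e ∈ Ideal.span ((fun z : X₁.presheaf.stalk b => z ^ p ^ e) '' (Ideal.span (Set.range s) : Set (X₁.presheaf.stalk b)))) → y ∈ Ideal.span (Set.range s)) →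
      ∃ J : X₁.IdealSheafData, J ≠ ⊥ ∧ b ∈ (J.support : Set X₁) ∧
        ∀ (X' : Scheme.{0}) (π : X' ⟶ X₁), Literature.AlgebraicGeometry.Resolution.IsBlowup π J →
          ∀ x' : X', π.base x' ∈ (J.support : Set X₁) → IsDomain (X'.presheaf.stalk x') ∧ ∀ d : ℕ, ringKrullDim (X'.presheaf.stalk x') = d → ∀ s : Fin d → X'.presheaf.stalk x', (Ideal.span (Set.range s)).radical.IsMaximal → RingTheory.Sequence.IsWeaklyRegular (X'.presheaf.stalk x') (List.ofFn s) ∧ ∀ y : X'.presheaf.stalk x', (∃ e : ℕ, y ^ p ^ e ∈ Ideal.span ((fun z : X'.presheaf.stalk x' => z ^ p ^ e) '' (Ideal.span (Set.range s) : Set (X'.presheaf.stalk x')))) → y ∈ Ideal.span (Set.range s)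

/-- **`#4β` holds for threefolds, given CP 2019 Thm. 1.1 (i)(ii), Raynaud–Gruson flattening and CP 2019 Prop. 4.4.**  The centre is
the ideal sheaf `𝓛` of the tree's one-blowing-up resolution `exists_isBlowup_isRegular_of_dim_three`: `Supp 𝓛 = X₁ ∖ Reg X₁ ∋ b`
(a bad point is not regular: `RegularPointClause.fiClause_of_mem_regularLocus`), and every blowing up along `𝓛` is isomorphic to the
regular `T` (`IsBlowup.unique`, `Scheme.IsRegular.of_iso`), hence FULL at every point.
[cite: CossartPiltant2019, Thm. 1.1 (i)(ii); Prop. 4.4] [cite: StacksProject, Tag 081T; Tag 080B]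
[cite: Matsumura1987, Thm. 17.4] [cite: Kunz1969, Thm. 2.1] -/
theorem closedCentreExistsDimEq3_of_cp
    (hG : CossartPiltant2019General.{0}) (h081R : Stacks081R.{0}) (hP : CossartPiltant2019Principalization.{0}) :
    ClosedCentreExistsDimEq3 := by
  intro p hp k _ _ X₁ f₁ hs hl hq hi hdim _ _ b _ hb
  haveI : Fact p.Prime := ⟨hp⟩
  haveI := hs
  haveI := hl
  haveI := hq
  haveI := hi
  haveI : X₁.IsSeparated := Scheme.isSeparated_of_isSeparated_over f₁
  haveI : IsNoetherian X₁ := Scheme.isNoetherian_of_finiteType_over_field f₁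
  obtain ⟨𝓛, T, ρ, h𝓛ne, hρ, hTreg, U, hU, h𝓛supp, -⟩ :=
    exists_isBlowup_isRegular_of_dim_three hG h081R hP f₁ hdim
  have hsupp : (𝓛.support : Set X₁) = (Scheme.regularLocus X₁)ᶜ :=
    CP2019.support_eq_compl_regularLocus_of_isBlowup_of_isRegular hρ hTreg (hU ▸ h𝓛supp)
  refine ⟨𝓛, h𝓛ne, ?_, ?_⟩
  · -- the bad point `b` is not regular, hence lies in `Supp 𝓛 = X₁ ∖ Reg X₁`
    rw [hsupp]
    intro hreg
    exact hb fun d hd s hrad => ((RegularPointClause.fiClause_of_mem_regularLocus p f₁ b hreg).2 d hd s hrad).2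
  · -- any blowing up along `𝓛` is isomorphic to `ρ`, whose source is regular
    intro X' π hπ x' _
    obtain ⟨e, -, -⟩ := hρ.unique hπ
    have hX' : Scheme.IsRegular X' := Scheme.IsRegular.of_iso e.hom hTreg
    have hx' : x' ∈ Scheme.regularLocus X' := by
      rw [hX'.regularLocus_eq_univ]; trivial
    exact RegularPointClause.fiClause_of_mem_regularLocus p (π ≫ f₁) x' hx'

end Summit.ResolutionOfSingularities.ResolutionOfSingularities.Theorems.FInjectiveMacaulayfication.ClosedCentreDimEq3

end
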